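import Literature.Computability.QuantumComplexity.DesignAnticoncentration
import Literature.Computability.QuantumComplexity.QuantumMarginals
import Mathlib.Analysis.Matrix.Order
import Mathlib.Data.Matrix.PEquiv
import Mathlib.Analysis.SpecialFunctions.Log.Basic
import HarnessLib

/-!
# Purity and second Rényi entropy from two copies: the swap trick (Ekert et al. 2002; Daley et al. 2012)

A. K. Ekert, C. M. Alves, D. K. L. Oi, M. Horodecki, P. Horodecki, L. C. Kwek, *Direct estimations
of linear and nonlinear functionals of a quantum state*, Phys. Rev. Lett. **88**, 217901 (2002),
arXiv:quant-ph/0203016 [EkertEtAl2002]: with the swap operator `V|α⟩|β⟩ = |β⟩|α⟩`,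
eq. (2) "v = Tr V(ρ_a ⊗ ρ_b) = Tr ρ_a ρ_b", "the probability of finding the qubit in state |0⟩ …
v = 2P₀ − 1", "For pure states … Tr ρ_a ρ_b = |⟨α|β⟩|²", "If we put ρ_a = ρ_b = ρ then we obtain
an estimation of Tr ρ²".  A. J. Daley, H. Pichler, J. Schachenmayer, P. Zoller, *Measuring
entanglement growth in quench dynamics of bosons in an optical lattice*, Phys. Rev. Lett. **109**,
020505 (2012), arXiv:1205.1521 [DaleyEtAl2012]: the Rényi entropy
"S_n(ρ) = (1/(1−n)) log tr{ρⁿ}", "tr{ρⁿ} = tr{V_n ρ^{⊗n}}", the scheme "allows simultaneous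
measurement of S_n(ρ) for the whole state and for every reduced subsystem (i.e., ρ = ρ_A)", the
subsystem swap "V_2^ℛ = ∏_{j∈ℛ} V_2^{{j}}" of commuting local swaps whose "two eigenvalues … are ±1"
with "(anti-)symmetric" eigenspaces.

pub-qadeq lane, CLAIMS row **E-50** (Zheng et al., USTC, PRX 16, 021057 (2026) = arXiv:2210.08556,
'Quantifying quantum computational advantage on a processor of ultracold atoms' [ZhengEtAl2026]):
§V "We perform many-body interference to measure the second-order Rényi entanglement entropy [47–53]
S₂^A = −ln Tr(ρ_A²), where ρ_A is the reduced density matrix of subsystem A. Two copies of the chain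
are selected …", App. A3 eq. (A1) "The second-order Rényi entropy is directly related to the purity
[75] S₂^A = −ln Tr(ρ_A²) = −ln⟨P_i(A)⟩" (its [75] = [DaleyEtAl2012]) and "The purity of the initial
Fock state is estimated to be ⟨P_i⟩ = 1 − 2 × P(1,1)". This file fixes the finite-dimensional
linear algebra behind that derived observable (matrices over `ℂ`, Hilbert spaces `ℂ^m`, `ℂ^m ⊗ ℂ^n`
as product index types, the tree's Kronecker product `⊗ₖ`, swap operator `swapOp` and partial
trace `traceRight`):

* `swapOp_eq_toMatrix` (the tree's swap `F_{(a,c),(b,d)} = [a=d][c=b]` is the permutation matrix of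
  `Prod.swap`), `swapOp_mulVec_kron` (`V(x ⊗ y) = y ⊗ x`), `swapOp_mul_swapOp` (`V² = 1`),
  `conjTranspose_swapOp` (`V† = V`);
* **`trace_swapOp_mul_kronecker`** — Ekert et al. eq. (2): `Tr(V(A ⊗ B)) = Tr(AB)`; `…_self`
  (`Tr(V(ρ ⊗ ρ)) = Tr ρ²`), `trace_proj_mul_proj` (pure states: `Tr(|α⟩⟨α| |β⟩⟨β|) = |⟨α|β⟩|²`);
* the symmetric / antisymmetric projectors `symProj = ½(1 + V)`, `antisymProj = ½(1 − V)`
  (idempotent, Hermitian, complementary) and the **outcome statistics**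
  `trace_kronecker_mul_antisymProj` (`Tr((ρ⊗σ)P₋) = (Tr ρ Tr σ − Tr(ρσ))/2`), hence for unit traces
  **`trace_mul_eq_one_sub_two_mul`** (`Tr(ρσ) = 1 − 2·Pr(−)` — Ekert's "v = 2P₀ − 1", E-50's
  "⟨P_i⟩ = 1 − 2 × P(1,1)"); `antisym_outcome_nonneg` (`Pr(−) ≥ 0` for density matrices, via
  Mathlib's `PosSemidef.kronecker`) and the consequence `trace_mul_le_one` (`Tr(ρσ) ≤ 1`, so the
  purity of a density matrix is at most one, `purity_le_one`);
* the **subsystem swap** on two copies of `ℂ^m ⊗ ℂ^n`: `leftSwap` / `swapLeft` (exchange the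
  `A = ℂ^m` factors of the two copies), `swapRight`, `swapLeft_mul_swapLeft` (`= 1`),
  `conjTranspose_swapLeft`, `swapLeft_mul_swapRight` (`V_A V_B = V`, Daley's product of local swaps),
  `commute_swapLeft_swapRight`, and **`trace_swapLeft_mul_kronecker`**:
  `Tr(V_A (ρ ⊗ σ)) = Tr(tr_B ρ · tr_B σ)` — with `σ = ρ` the reduced purity `Tr(ρ_A²)` of Daley et al.
  and E-50 (A1);
* `renyiTwo ρ = −log Tr(ρ²)` (Daley's `S_n` at `n = 2`, E-50's `S₂`) and `renyiTwo_traceRight`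
  (`S₂(ρ_A) = −log Tr(V_A (ρ⊗ρ))`, E-50 eq. (A1)).

Not covered: the bosonic implementation (beam splitter `a_{i,1} → (a_{i,1}+a_{i,2})/√2`, parity of
the atom number in copy 2 as the measured value of `V_2^ℛ`, Daley eq. (2) and the Fock-space argument),
general `n` (cyclic shift `V_n`, Ekert eqs. (3)–(4)), the controlled-swap interferometer, finite
statistics, anything about a device or about E-50's numbers.

'instance-level adjudication of specific advantage claims; no claim about BQP vs BPP or the summit'.

## References

* [EkertEtAl2002] A. K. Ekert et al., PRL 88, 217901 (2002) — eq. (2) and the surrounding text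
  (held text `paper:arxiv-quant-ph_0203016`, chunk p0002).
* [DaleyEtAl2012] A. J. Daley, H. Pichler, J. Schachenmayer, P. Zoller, PRL 109, 020505 (2012) —
  p1–p2: `S_n`, `tr{ρⁿ} = tr{V_n ρ^{⊗n}}`, subsystem swaps (held text `paper:arxiv-1205.1521`,
  chunks p0002–p0004).
* [ZhengEtAl2026] Y.-G. Zheng et al., PRX 16, 021057 (2026) — §V and App. A3 eq. (A1) (E-50 link).

## Mathlib / tree search

Reused: `Literature.Computability.QuantumComplexity.DesignAnticoncentration.swapOp` / `proj`
(Zhu–Kueng–Grassl–Gross flip operator and rank-one projector), `…QuantumComplexity.traceRight`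
(partial trace, QuantumMarginals.lean), Mathlib `Matrix.kroneckerMap`, `Matrix.trace_kronecker`,
`Matrix.PosSemidef.kronecker`, `PEquiv.toMatrix` (permutation matrices). Dedup:
`lean search 'trace_swap|swapOp_|partial swap'` → no trace identity for the swap in `Literature/`
(`MathematicalPhysics/QuantumManyBody/SwapPurity.lean` is the continuum Bose-gas swap purity of
wavefunctions, a different object); Summits-side files have their own `swapMatrix_mul_kronecker`
which `Literature/` cannot import.
-/

noncomputable section

open Matrix Finset
open scoped Kronecker ComplexOrder MatrixOrder
open Literature.Computability.QuantumComplexity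
open Literature.Computability.QuantumComplexity.DesignAnticoncentration

namespace Literature.InformationTheory.Entanglement

namespace TwoCopy

variable {m n : Type*} [Fintype m] [Fintype n] [DecidableEq m] [DecidableEq n]

/-! ### The swap operator on `ℂ^m ⊗ ℂ^m` -/

omit [Fintype m] in
/-- Entries of the swap: `V_{(a,c),(b,d)} = [a = d][c = b]`. [cite: EkertEtAl2002, p0002 ("V is the swap operator, defined as V|α⟩_A|β⟩_B = |β⟩_A|α⟩_B")] -/
theorem swapOp_apply (p q : m × m) : swapOp m p q = if p.1 = q.2 ∧ p.2 = q.1 then 1 else 0 := rfl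

omit [Fintype m] in
/-- The swap is the permutation matrix of `Prod.swap` (`(m × m) ≃ (m × m)`, `Equiv.prodComm`).
[cite: EkertEtAl2002, p0002 (definition of V)] -/
theorem swapOp_eq_toMatrix :
    swapOp m = ((Equiv.prodComm m m).toPEquiv.toMatrix : Matrix (m × m) (m × m) ℂ) := by
  ext p q
  rw [swapOp_apply, PEquiv.toMatrix_apply]
  have : q ∈ (Equiv.prodComm m m).toPEquiv p ↔ p.1 = q.2 ∧ p.2 = q.1 := by
    rw [Equiv.toPEquiv_apply, Option.mem_def, Option.some.injEq, Equiv.prodComm_apply,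
      Prod.ext_iff, Prod.fst_swap, Prod.snd_swap]
    constructor
    · rintro ⟨h1, h2⟩; exact ⟨h2, h1⟩
    · rintro ⟨h1, h2⟩; exact ⟨h2, h1⟩
  simp only [this]

/-- `V (x ⊗ y) = y ⊗ x` on product vectors. [cite: EkertEtAl2002, p0002 ("V|α⟩_A|β⟩_B = |β⟩_A|α⟩_B")]; [cite: DaleyEtAl2012, p0002 ("V_n|ψ_1⟩…|ψ_n⟩ = |ψ_n⟩|ψ_1⟩…|ψ_{n−1}⟩")] -/
theorem swapOp_mulVec_kron (x y : m → ℂ) :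
    swapOp m *ᵥ (fun p : m × m => x p.1 * y p.2) = fun p => y p.1 * x p.2 := by
  ext p
  rw [Matrix.mulVec, dotProduct, Finset.sum_eq_single (p.2, p.1)]
  · rw [swapOp_apply, if_pos ⟨rfl, rfl⟩, one_mul, mul_comm]
  · rintro q - hq
    rw [swapOp_apply, if_neg, zero_mul]
    rintro ⟨h1, h2⟩
    exact hq (Prod.ext h2.symm h1.symm)
  · intro h; exact absurd (Finset.mem_univ _) h

/-- `V² = 1` (so the eigenvalues of the Hermitian `V` are `±1`).
[cite: DaleyEtAl2012, p0004 ("the two eigenvalues of the (hermitean) operators V_2^ℛ, which are ±1")] -/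
theorem swapOp_mul_swapOp : swapOp m * swapOp m = (1 : Matrix (m × m) (m × m) ℂ) := by
  rw [swapOp_eq_toMatrix, ← PEquiv.toMatrix_trans, ← Equiv.toPEquiv_trans]
  have : (Equiv.prodComm m m).trans (Equiv.prodComm m m) = Equiv.refl _ := by
    ext p <;> rfl
  rw [this, Equiv.toPEquiv_refl, PEquiv.toMatrix_refl]

omit [Fintype m] in
/-- `V† = V`. [cite: DaleyEtAl2012, p0004 ("(hermitean) operators V_2^ℛ")] -/
theorem conjTranspose_swapOp : (swapOp m)ᴴ = swapOp m := by
  ext p q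
  simp only [conjTranspose_apply, swapOp_apply]
  by_cases h : p.1 = q.2 ∧ p.2 = q.1
  · rw [if_pos h, if_pos ⟨h.2.symm, h.1.symm⟩, star_one]
  · rw [if_neg h, if_neg (fun h' => h ⟨h'.2.symm, h'.1.symm⟩), star_zero]

/-! ### Ekert et al. eq. (2): `Tr(V(A ⊗ B)) = Tr(AB)` -/

/-- **The swap trick** (Ekert et al. eq. (2)): `Tr(V (A ⊗ B)) = Tr(A B)`.
[cite: EkertEtAl2002, eq. (2) ("v = Tr V(ρ_a ⊗ ρ_b) = Tr ρ_a ρ_b")]; [cite: DaleyEtAl2012, p0002 ("tr{ρⁿ} = tr{V_n ρ^{⊗n}}", n = 2)] -/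
theorem trace_swapOp_mul_kronecker (A B : Matrix m m ℂ) :
    (swapOp m * (A ⊗ₖ B)).trace = (A * B).trace := by
  rw [swapOp_eq_toMatrix, PEquiv.toMatrix_toPEquiv_mul]
  simp only [Matrix.trace, Matrix.diag_apply, Matrix.submatrix_apply, id, Equiv.prodComm_apply,
    Matrix.kroneckerMap_apply, Matrix.mul_apply]
  rw [Fintype.sum_prod_type]
  simp only [Prod.swap_prod_mk]
  rw [Finset.sum_comm]

/-- "If we put `ρ_a = ρ_b = ρ` then we obtain an estimation of `Tr ρ²`": `Tr(V (ρ ⊗ ρ)) = Tr(ρ²)`.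
[cite: EkertEtAl2002, p0002 ("If we put ρ_a = ρ_b = ρ then we obtain an estimation of tr ρ²")] -/
theorem trace_swapOp_mul_kronecker_self (ρ : Matrix m m ℂ) :
    (swapOp m * (ρ ⊗ₖ ρ)).trace = (ρ * ρ).trace :=
  trace_swapOp_mul_kronecker ρ ρ

omit [DecidableEq m] in
/-- Pure states: `Tr(|α⟩⟨α| |β⟩⟨β|) = |⟨α|β⟩|²` (with the tree's `proj ψ = |ψ⟩⟨ψ|`).
[cite: EkertEtAl2002, p0002 ("For pure states ρ_a = |α⟩⟨α| and ρ_b = |β⟩⟨β| the formula above gives tr ρ_aρ_b = |⟨α|β⟩|²")] -/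
theorem trace_proj_mul_proj (α β : m → ℂ) :
    (proj α * proj β).trace = (star α ⬝ᵥ β) * star (star α ⬝ᵥ β) := by
  rw [proj, proj, Matrix.vecMulVec_mul_vecMulVec, Matrix.trace_vecMulVec, dotProduct_smul, smul_eq_mul,
    dotProduct_comm α (star β), star_dotProduct, star_star]

/-- The same with `V`: `Tr(V(|α⟩⟨α| ⊗ |β⟩⟨β|)) = |⟨α|β⟩|²` ("a direct measure of orthogonality of
|α⟩ and |β⟩"). [cite: EkertEtAl2002, eq. (2) and p0002 ("a direct measure of orthogonality")] -/
theorem trace_swapOp_mul_kronecker_proj (α β : m → ℂ) :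
    (swapOp m * (proj α ⊗ₖ proj β)).trace = (star α ⬝ᵥ β) * star (star α ⬝ᵥ β) := by
  rw [trace_swapOp_mul_kronecker, trace_proj_mul_proj]

/-! ### Symmetric / antisymmetric outcomes: `v = 2P₀ − 1` -/

/-- Projector onto the symmetric subspace, `P₊ = ½(1 + V)`. [cite: DaleyEtAl2012, p0004 ("The eigenspaces of V_2^ℛ are the subspaces … (anti-)symmetric with respect to exchange of the two copies")] -/
def symProj (m : Type*) [DecidableEq m] : Matrix (m × m) (m × m) ℂ := (1 / 2 : ℂ) • (1 + swapOp m)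

/-- Projector onto the antisymmetric subspace, `P₋ = ½(1 − V)`. [cite: DaleyEtAl2012, p0004 ("The anti-symmetric subspace")] -/
def antisymProj (m : Type*) [DecidableEq m] : Matrix (m × m) (m × m) ℂ := (1 / 2 : ℂ) • (1 - swapOp m)

omit [Fintype m] in
/-- Unfolding of `symProj`. [cite: DaleyEtAl2012, p0004] -/
theorem symProj_eq : symProj m = (1 / 2 : ℂ) • (1 + swapOp m) := rfl

omit [Fintype m] in
/-- Unfolding of `antisymProj`. [cite: DaleyEtAl2012, p0004] -/
theorem antisymProj_eq : antisymProj m = (1 / 2 : ℂ) • (1 - swapOp m) := rfl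

omit [Fintype m] in
/-- `P₊ + P₋ = 1`. [cite: DaleyEtAl2012, p0004 (the two eigenspaces)] -/
theorem symProj_add_antisymProj : symProj m + antisymProj m = 1 := by
  rw [symProj_eq, antisymProj_eq, ← smul_add, add_add_sub_cancel, ← two_smul ℂ, smul_smul]
  norm_num

omit [Fintype m] in
/-- `V = P₊ − P₋` (outcome `+1` on the symmetric, `−1` on the antisymmetric subspace).
[cite: DaleyEtAl2012, p0004 ("the measurement outcome of V^{j} is +1 … and −1 …")] -/
theorem symProj_sub_antisymProj : symProj m - antisymProj m = swapOp m := by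
  rw [symProj_eq, antisymProj_eq, ← smul_sub, add_sub_sub_cancel, ← two_smul ℂ, smul_smul]
  norm_num

/-- `P₋² = P₋`. [cite: DaleyEtAl2012, p0004 (eigenspaces of V)] -/
theorem antisymProj_mul_self : antisymProj m * antisymProj m = antisymProj m := by
  rw [antisymProj_eq, smul_mul_smul_comm, sub_mul, mul_sub, mul_sub, one_mul, mul_one, one_mul,
    swapOp_mul_swapOp]
  rw [show (1 : Matrix (m × m) (m × m) ℂ) - swapOp m - (swapOp m - 1) = (2 : ℂ) • (1 - swapOp m) by
    rw [two_smul]; abel, smul_smul]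
  norm_num

/-- `P₊² = P₊`. [cite: DaleyEtAl2012, p0004 (eigenspaces of V)] -/
theorem symProj_mul_self : symProj m * symProj m = symProj m := by
  rw [symProj_eq, smul_mul_smul_comm, add_mul, mul_add, mul_add, one_mul, mul_one, one_mul,
    swapOp_mul_swapOp]
  rw [show (1 : Matrix (m × m) (m × m) ℂ) + swapOp m + (swapOp m + 1) = (2 : ℂ) • (1 + swapOp m) by
    rw [two_smul]; abel, smul_smul]
  norm_num

omit [Fintype m] in
/-- `P₋† = P₋`. [cite: DaleyEtAl2012, p0004 ("hermitean")] -/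
theorem conjTranspose_antisymProj : (antisymProj m)ᴴ = antisymProj m := by
  rw [antisymProj_eq, conjTranspose_smul, conjTranspose_sub, conjTranspose_one, conjTranspose_swapOp]
  norm_num

omit [Fintype m] in
/-- `P₊† = P₊`. [cite: DaleyEtAl2012, p0004 ("hermitean")] -/
theorem conjTranspose_symProj : (symProj m)ᴴ = symProj m := by
  rw [symProj_eq, conjTranspose_smul, conjTranspose_add, conjTranspose_one, conjTranspose_swapOp]
  norm_num

/-- **Antisymmetric outcome probability**: `Tr((ρ ⊗ σ) P₋) = (Tr ρ · Tr σ − Tr(ρσ))/2`.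
[cite: EkertEtAl2002, p0002 ("P₀ is related to the visibility by v = 2P₀ − 1")]; [cite: DaleyEtAl2012, p0004 (±1 outcomes of V_2^ℛ)] -/
theorem trace_kronecker_mul_antisymProj (ρ σ : Matrix m m ℂ) :
    ((ρ ⊗ₖ σ) * antisymProj m).trace = (ρ.trace * σ.trace - (ρ * σ).trace) / 2 := by
  rw [antisymProj_eq, Matrix.mul_smul, Matrix.trace_smul, Matrix.mul_sub, Matrix.mul_one,
    Matrix.trace_sub, Matrix.trace_kronecker, Matrix.trace_mul_comm, trace_swapOp_mul_kronecker,
    smul_eq_mul]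
  ring

/-- **Symmetric outcome probability**: `Tr((ρ ⊗ σ) P₊) = (Tr ρ · Tr σ + Tr(ρσ))/2`.
[cite: EkertEtAl2002, p0002 ("v = 2P₀ − 1")] -/
theorem trace_kronecker_mul_symProj (ρ σ : Matrix m m ℂ) :
    ((ρ ⊗ₖ σ) * symProj m).trace = (ρ.trace * σ.trace + (ρ * σ).trace) / 2 := by
  rw [symProj_eq, Matrix.mul_smul, Matrix.trace_smul, Matrix.mul_add, Matrix.mul_one,
    Matrix.trace_add, Matrix.trace_kronecker, Matrix.trace_mul_comm, trace_swapOp_mul_kronecker,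
    smul_eq_mul]
  ring

/-- For unit-trace `ρ, σ`: **`Tr(ρσ) = 1 − 2·Pr(antisymmetric)`** — Ekert's `v = 2P₀ − 1`
(`P₀ = Pr(symmetric)`), E-50's "⟨P_i⟩ = 1 − 2 × P(1,1)".
[cite: EkertEtAl2002, p0002 ("v = 2P₀ − 1")]; [cite: ZhengEtAl2026, App. A3 ("The purity of the initial Fock state is estimated to be ⟨P_i⟩ = 1 − 2 × P(1,1)")] -/
theorem trace_mul_eq_one_sub_two_mul {ρ σ : Matrix m m ℂ} (hρ : ρ.trace = 1) (hσ : σ.trace = 1) :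
    (ρ * σ).trace = 1 - 2 * ((ρ ⊗ₖ σ) * antisymProj m).trace := by
  rw [trace_kronecker_mul_antisymProj, hρ, hσ]; ring

/-- … equivalently `Tr(ρσ) = 2·Pr(symmetric) − 1`. [cite: EkertEtAl2002, p0002 ("v = 2P₀ − 1")] -/
theorem trace_mul_eq_two_mul_sub_one {ρ σ : Matrix m m ℂ} (hρ : ρ.trace = 1) (hσ : σ.trace = 1) :
    (ρ * σ).trace = 2 * ((ρ ⊗ₖ σ) * symProj m).trace - 1 := by
  rw [trace_kronecker_mul_symProj, hρ, hσ]; ring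

omit [DecidableEq m] in
/-- `0 ≤ Tr(τ X)` for positive semidefinite `τ` and `X` (through `τ = BᴴB`, Mathlib's matrix star
order). [folklore] -/
private theorem trace_mul_nonneg_of_posSemidef {k : Type*} [Fintype k] [DecidableEq k]
    {τ X : Matrix k k ℂ} (hτ : τ.PosSemidef) (hX : X.PosSemidef) : 0 ≤ (τ * X).trace := by
  obtain ⟨B, hB⟩ : ∃ B : Matrix k k ℂ, τ = Bᴴ * B := by
    obtain ⟨T, hT, -, hTT⟩ :=
      CFC.exists_sqrt_of_isSelfAdjoint_of_quasispectrumRestricts hτ.isHermitian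
        (QuasispectrumRestricts.nnreal_of_nonneg hτ.nonneg)
    exact ⟨T, by rw [← hTT, ← star_eq_conjTranspose, hT.star_eq]⟩
  rw [hB, Matrix.mul_assoc, Matrix.trace_mul_comm]
  exact (hX.mul_mul_conjTranspose_same B).trace_nonneg

/-- `P₋` is positive semidefinite (`P₋ = P₋ᴴ P₋`). [cite: DaleyEtAl2012, p0004 (P₋ projects onto the anti-symmetric subspace)] -/
theorem posSemidef_antisymProj : (antisymProj m).PosSemidef := by
  have h : antisymProj m = (antisymProj m)ᴴ * antisymProj m := by
    rw [conjTranspose_antisymProj, antisymProj_mul_self]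
  rw [h]
  exact posSemidef_conjTranspose_mul_self _

/-- **The antisymmetric outcome has non-negative probability** for states: `0 ≤ Tr((ρ⊗σ)P₋)` when
`ρ, σ ⪰ 0` (Mathlib: `ρ ⊗ σ ⪰ 0`). [cite: DaleyEtAl2012, p0004 (measurement outcomes of V_2^ℛ)]; [cite: ZhengEtAl2026, App. A3 ("the joint probability P(1,1)")] -/
theorem antisym_outcome_nonneg {ρ σ : Matrix m m ℂ} (hρ : ρ.PosSemidef) (hσ : σ.PosSemidef) :
    0 ≤ ((ρ ⊗ₖ σ) * antisymProj m).trace :=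
  trace_mul_nonneg_of_posSemidef (hρ.kronecker hσ) posSemidef_antisymProj

/-- Consequence: **`Tr(ρσ) ≤ 1`** for density matrices `ρ, σ` (unit trace, `⪰ 0`) — the overlap
measured by the swap test is at most one. [cite: EkertEtAl2002, eq. (2) with "v = 2P₀ − 1" (P₀ ≤ 1)] -/
theorem trace_mul_le_one {ρ σ : Matrix m m ℂ} (hρ : ρ.PosSemidef) (hσ : σ.PosSemidef)
    (hρ1 : ρ.trace = 1) (hσ1 : σ.trace = 1) : (ρ * σ).trace.re ≤ 1 := by
  have h := antisym_outcome_nonneg hρ hσ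
  rw [trace_mul_eq_one_sub_two_mul hρ1 hσ1]
  have h' := (Complex.nonneg_iff.mp h).1
  simp only [Complex.sub_re, Complex.one_re, Complex.mul_re, Complex.re_ofNat, Complex.im_ofNat,
    zero_mul, sub_zero]
  linarith

/-- In particular the **purity** of a density matrix is at most one, `Tr(ρ²) ≤ 1`.
[cite: EkertEtAl2002, p0002 ("we obtain an estimation of tr ρ²")] -/
theorem purity_le_one {ρ : Matrix m m ℂ} (hρ : ρ.PosSemidef) (hρ1 : ρ.trace = 1) :
    (ρ * ρ).trace.re ≤ 1 :=
  trace_mul_le_one hρ hρ hρ1 hρ1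

/-! ### Subsystem swaps on two copies of `ℂ^m ⊗ ℂ^n` -/

/-- Exchange of the `A = ℂ^m` coordinates of two copies of `ℂ^m ⊗ ℂ^n`:
`((a,b),(a',b')) ↦ ((a',b),(a,b'))` (an involution of the product basis).
[cite: DaleyEtAl2012, p0003 ("the swap operator V_n^ℛ for all possible subsystems being swapped, ℛ")] -/
def leftSwap (m n : Type*) : (m × n) × (m × n) ≃ (m × n) × (m × n) where
  toFun p := ((p.2.1, p.1.2), (p.1.1, p.2.2))
  invFun p := ((p.2.1, p.1.2), (p.1.1, p.2.2))
  left_inv _ := rfl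
  right_inv _ := rfl

/-- Exchange of the `B = ℂ^n` coordinates of the two copies: `((a,b),(a',b')) ↦ ((a,b'),(a',b))`.
[cite: DaleyEtAl2012, p0003 (subsystem swaps V_n^ℛ)] -/
def rightSwap (m n : Type*) : (m × n) × (m × n) ≃ (m × n) × (m × n) where
  toFun p := ((p.1.1, p.2.2), (p.2.1, p.1.2))
  invFun p := ((p.1.1, p.2.2), (p.2.1, p.1.2))
  left_inv _ := rfl
  right_inv _ := rfl

omit [Fintype m] [Fintype n] [DecidableEq m] [DecidableEq n] in
/-- Action of `leftSwap`. [cite: DaleyEtAl2012, p0003] -/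
@[simp] theorem leftSwap_apply (p : (m × n) × (m × n)) :
    leftSwap m n p = ((p.2.1, p.1.2), (p.1.1, p.2.2)) := rfl

omit [Fintype m] [Fintype n] [DecidableEq m] [DecidableEq n] in
/-- Action of `rightSwap`. [cite: DaleyEtAl2012, p0003] -/
@[simp] theorem rightSwap_apply (p : (m × n) × (m × n)) :
    rightSwap m n p = ((p.1.1, p.2.2), (p.2.1, p.1.2)) := rfl

/-- The **subsystem swap** `V_A` of the `ℂ^m` factors on two copies of `ℂ^m ⊗ ℂ^n`, as a
permutation matrix. [cite: DaleyEtAl2012, p0003–p0004 ("V_2^ℛ = ∏_{j∈ℛ} V_2^{{j}}")] -/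
def swapLeft (m n : Type*) [DecidableEq m] [DecidableEq n] :
    Matrix ((m × n) × (m × n)) ((m × n) × (m × n)) ℂ :=
  (leftSwap m n).toPEquiv.toMatrix

/-- The subsystem swap `V_B` of the `ℂ^n` factors. [cite: DaleyEtAl2012, p0003–p0004 (V_2^ℛ)] -/
def swapRight (m n : Type*) [DecidableEq m] [DecidableEq n] :
    Matrix ((m × n) × (m × n)) ((m × n) × (m × n)) ℂ :=
  (rightSwap m n).toPEquiv.toMatrix

/-- `V_A M` permutes the rows of `M` by `leftSwap`. [cite: DaleyEtAl2012, p0003 (V_2^ℛ)] -/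
theorem swapLeft_mul (M : Matrix ((m × n) × (m × n)) ((m × n) × (m × n)) ℂ) :
    swapLeft m n * M = M.submatrix (leftSwap m n) id :=
  PEquiv.toMatrix_toPEquiv_mul _ _

/-- `V_A² = 1`. [cite: DaleyEtAl2012, p0004 ("eigenvalues … ±1")] -/
theorem swapLeft_mul_swapLeft : swapLeft m n * swapLeft m n = 1 := by
  rw [swapLeft, ← PEquiv.toMatrix_trans, ← Equiv.toPEquiv_trans]
  have : (leftSwap m n).trans (leftSwap m n) = Equiv.refl _ := by ext p <;> rfl
  rw [this, Equiv.toPEquiv_refl, PEquiv.toMatrix_refl]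

omit [Fintype m] [Fintype n] in
/-- `V_A† = V_A` (a real symmetric permutation matrix of an involution).
[cite: DaleyEtAl2012, p0004 ("(hermitean) operators V_2^ℛ")] -/
theorem conjTranspose_swapLeft : (swapLeft m n)ᴴ = swapLeft m n := by
  have hsymm : (leftSwap m n).symm = leftSwap m n := rfl
  have hT : (swapLeft m n)ᵀ = swapLeft m n := by
    rw [swapLeft, ← PEquiv.toMatrix_symm, ← Equiv.toPEquiv_symm, hsymm]
  rw [conjTranspose, hT]
  ext p q
  simp only [map_apply, swapLeft, PEquiv.toMatrix_apply]
  split_ifs <;> simp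

/-- **`V_A V_B = V`**: swapping both factors of the two copies is the full swap of `ℂ^m ⊗ ℂ^n`
(Daley's product of commuting local swaps). [cite: DaleyEtAl2012, p0004 ("V_2^ℛ = ∏_{j∈ℛ} V_2^{{j}}")] -/
theorem swapLeft_mul_swapRight : swapLeft m n * swapRight m n = swapOp (m × n) := by
  rw [swapLeft, swapRight, ← PEquiv.toMatrix_trans, ← Equiv.toPEquiv_trans, swapOp_eq_toMatrix]
  have : (leftSwap m n).trans (rightSwap m n) = Equiv.prodComm (m × n) (m × n) := by ext p <;> rfl
  rw [this]

/-- The subsystem swaps commute: `V_A V_B = V_B V_A`. [cite: DaleyEtAl2012, p0004 ("all of the V_2^{{j}} commute")] -/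
theorem commute_swapLeft_swapRight : Commute (swapLeft m n) (swapRight m n) := by
  have h1 : swapLeft m n * swapRight m n = swapOp (m × n) := swapLeft_mul_swapRight
  have h2 : swapRight m n * swapLeft m n = swapOp (m × n) := by
    rw [swapLeft, swapRight, ← PEquiv.toMatrix_trans, ← Equiv.toPEquiv_trans, swapOp_eq_toMatrix]
    have : (rightSwap m n).trans (leftSwap m n) = Equiv.prodComm (m × n) (m × n) := by ext p <;> rfl
    rw [this]
  exact h1.trans h2.symm

/-- **Reduced purity from the subsystem swap** (Daley et al.; E-50 eq. (A1)):
`Tr(V_A (ρ ⊗ σ)) = Tr(tr_B ρ · tr_B σ)`; with `σ = ρ` the right-hand side is the purity `Tr(ρ_A²)`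
of the reduced state `ρ_A = tr_B ρ`. [cite: DaleyEtAl2012, p0003 ("this scheme allows simultaneous measurement of S_n(ρ) for the whole state and for every reduced subsystem (i.e., ρ = ρ_A)")];
[cite: ZhengEtAl2026, App. A3 eq. (A1) ("S₂^A = −ln Tr(ρ_A²) = −ln⟨P_i(A)⟩")] -/
theorem trace_swapLeft_mul_kronecker (ρ σ : Matrix (m × n) (m × n) ℂ) :
    (swapLeft m n * (ρ ⊗ₖ σ)).trace = (traceRight ρ * traceRight σ).trace := by
  rw [swapLeft_mul]
  simp only [Matrix.trace, Matrix.diag_apply, Matrix.submatrix_apply, id, leftSwap_apply,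
    Matrix.kroneckerMap_apply, Matrix.mul_apply, traceRight_apply, Finset.sum_mul_sum,
    Fintype.sum_prod_type]
  -- both sides are `Σ_{a,b,a',b'} ρ_{(a',b),(a,b)} σ_{(a,b'),(a',b')}` up to the order of summation:
  -- left `(a, b, a', b')`, right `(a', a, b, b')`
  symm
  rw [Finset.sum_comm]
  refine Finset.sum_congr rfl fun a _ => ?_
  rw [Finset.sum_comm]

/-- The reduced purity: `Tr(V_A (ρ ⊗ ρ)) = Tr(ρ_A²)`, `ρ_A = tr_B ρ`. [cite: DaleyEtAl2012, p0003 (ρ = ρ_A)]; [cite: ZhengEtAl2026, App. A3 eq. (A1)] -/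
theorem trace_swapLeft_mul_kronecker_self (ρ : Matrix (m × n) (m × n) ℂ) :
    (swapLeft m n * (ρ ⊗ₖ ρ)).trace = (traceRight ρ * traceRight ρ).trace :=
  trace_swapLeft_mul_kronecker ρ ρ

/-! ### The second Rényi entropy -/

/-- The **second Rényi entropy** `S₂(ρ) = −log Tr(ρ²)` (natural logarithm; `S_n = log tr ρⁿ/(1−n)`
at `n = 2`). [cite: DaleyEtAl2012, p0002 ("S_n(ρ) = 1/(1−n) log tr{ρⁿ}")]; [cite: ZhengEtAl2026, §V ("S₂^A = −ln Tr(ρ_A²)")] -/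
def renyiTwo {k : Type*} [Fintype k] (ρ : Matrix k k ℂ) : ℝ := -Real.log (ρ * ρ).trace.re

omit [DecidableEq m] in
/-- Unfolding of `renyiTwo`. [cite: DaleyEtAl2012, p0002 (S_n at n = 2)] -/
theorem renyiTwo_eq (ρ : Matrix m m ℂ) : renyiTwo ρ = -Real.log (ρ * ρ).trace.re := rfl

/-- **E-50 eq. (A1)**: the second Rényi entropy of the reduced state is minus the logarithm of the
two-copy subsystem-swap expectation, `S₂(ρ_A) = −log Tr(V_A (ρ ⊗ ρ))`.
[cite: ZhengEtAl2026, App. A3 eq. (A1) ("S₂^A = −ln Tr(ρ_A²) = −ln⟨P_i(A)⟩")]; [cite: DaleyEtAl2012, p0002–p0003] -/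
theorem renyiTwo_traceRight (ρ : Matrix (m × n) (m × n) ℂ) :
    renyiTwo (traceRight ρ) = -Real.log (swapLeft m n * (ρ ⊗ₖ ρ)).trace.re := by
  rw [renyiTwo, trace_swapLeft_mul_kronecker_self]

/-- `S₂(ρ) = −log Tr(V(ρ ⊗ ρ))` for the whole state. [cite: DaleyEtAl2012, p0002 ("the measurement of the Rényi entropy can be reduced to determining the expectation value ⟨V_n⟩ on the n copies")] -/
theorem renyiTwo_eq_neg_log_swap (ρ : Matrix m m ℂ) :
    renyiTwo ρ = -Real.log (swapOp m * (ρ ⊗ₖ ρ)).trace.re := by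
  rw [renyiTwo, trace_swapOp_mul_kronecker_self]

/-- `S₂(ρ) ≥ 0` for a density matrix whose purity is positive (`0 < Tr ρ² ≤ 1`).
[cite: DaleyEtAl2012, p0002 (S_n as an entanglement measure for reduced states of a pure state)] -/
theorem renyiTwo_nonneg {ρ : Matrix m m ℂ} (hρ : ρ.PosSemidef) (hρ1 : ρ.trace = 1)
    (hpos : 0 < (ρ * ρ).trace.re) : 0 ≤ renyiTwo ρ := by
  rw [renyiTwo, neg_nonneg]
  exact Real.log_nonpos hpos.le (purity_le_one hρ hρ1)

end TwoCopy

end Literature.InformationTheory.Entanglement
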